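import Literature.Algebra.EuclideanLattices.LLLCapModel
import Literature.Computability.Complexity.ZIntBricks
import Literature.Computability.Complexity.ListBricks
import HarnessLib

/-!
# The LLL machine, I: codes, dot products, the Gram table and Cohen's recursion level by level

Trunk: Lattice; first of the files realising the saturated integral LLL step `capStep W`
(`LLLCapModel.lean`) as a polynomial-time string function, towards the machine-level fact
`Literature.Algebra.EuclideanLattices.lllReduce_polyTime` (LLL82 Prop. 1.26). The machine is written
in the tree's `FP` string algebra (`BrickAlgebra.lean`, `ZIntBricks.lean`, `ListBricks.lean`): no
Turing machine is written by hand; every routine is a composition of total string functions whose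
membership in `FP` is by composition lemmas, whose value on genuine codes is an `_apply` lemma, and
whose output length is bounded on *every* input in the shape the loop lemmas need. All records carry
the **yardstick** `x` (a string of length `W`, the saturation width = the clock of every loop) as
their first field.

* codes: `rowCode v`, `matCode b` (a matrix is the coded list of its coded rows of canonical
  integer codes `dpEnc`), `zlist`, `tableCode W b l` (Cohen's table `uₗ(i,j)`, saturated);
* `dotF ⟨x, ⟨bin m, ⟨rowCode v, rowCode w⟩⟩⟩ = dpEnc (∑ₜ vₜ wₜ)` (exact, accumulated sign-free);
* `gramRowF`, `gramF ⟨x, ⟨bin n, matCode b⟩⟩ = tableCode |x| b 0` (the saturated Gram matrix,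
  `uRecCap W b 0 = capZ W ∘ intGram b`);
* `colF` (a column of a table), `levelF` — **one level of Cohen's recursion**
  `uₗ₊₁(i,j) = capZ ((uₗ(l,l) uₗ(i,j) - uₗ(j,l) uₗ(i,l)) / dₗ)`:
  `levelF ⟨x, ⟨bin n, ⟨bin l, ⟨dpEnc dₗ, tableCode |x| b l⟩⟩⟩⟩ = tableCode |x| b (l+1)`.

## References

* A. K. Lenstra, H. W. Lenstra Jr., L. Lovász, Math. Ann. 261 (1982), Prop. 1.26.
* H. Cohen, *A Course in Computational Algebraic Number Theory*, GTM 138, 1993, Algorithm 2.6.7.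
* S. Arora, B. Barak, *Computational Complexity: A Modern Approach*, CUP 2009, §1.3.
-/

noncomputable section

namespace Literature.Algebra.EuclideanLattices

open _root_.Computability Literature.Computability.Complexity Literature.Computability.Complexity.Brick Polynomial

namespace LLLMachine

/-! ### Codes -/

/-- The code of a list of integers: the coded list of their canonical codes. [folklore] -/
def zlist (l : List ℤ) : List Bool := encList (l.map dpEnc)

/-- The code of an integer vector. [folklore] -/
def rowCode {m : ℕ} (v : Fin m → ℤ) : List Bool := zlist (List.ofFn v)

/-- The code of an integer matrix: the coded list of its coded rows. [folklore] -/
def matCode {n m : ℕ} (b : Fin n → (Fin m → ℤ)) : List Bool := encList (List.ofFn fun i => rowCode (b i))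

/-- The code of Cohen's saturated table at level `l`: `uₗ(i,j)` for all `i, j < n`.
[cite: Cohen1993, Algorithm 2.6.7] -/
def tableCode {n m : ℕ} (W : ℕ) (b : Fin n → (Fin m → ℤ)) (l : ℕ) : List Bool :=
  encList (List.ofFn fun i : Fin n => zlist (List.ofFn fun j : Fin n => uRecCap W b l i j))

/-- `zlist` of a cons. [folklore] -/
@[simp] theorem zlist_cons (a : ℤ) (l : List ℤ) : zlist (a :: l) = boolPair (dpEnc a) (zlist l) := rfl

/-- `zlist []`. [folklore] -/
@[simp] theorem zlist_nil : zlist [] = [] := rfl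

/-- `zlist` as `encList`. [folklore] -/
theorem zlist_eq (l : List ℤ) : zlist l = encList (l.map dpEnc) := rfl

/-- The `k`-th item of a `zlist`. [folklore] -/
theorem getD_map_dpEnc (l : List ℤ) (k : ℕ) (hk : k < l.length) : (l.map dpEnc).getD k [] = dpEnc (l[k]) := by
  simp [List.getD_eq_getElem?_getD, List.getElem?_eq_getElem hk]

/-- Rows of a matrix code. [folklore] -/
theorem getD_ofFn_rowCode {n m : ℕ} (b : Fin n → (Fin m → ℤ)) (i : Fin n) :
    (List.ofFn fun i => rowCode (b i)).getD i [] = rowCode (b i) := by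
  simp [List.getD_eq_getElem?_getD]

/-! ### The dot product -/

/-- The accumulation step of the dot product on `⟨x, ⟨p, ⟨a, ⟨b, acc⟩⟩⟩⟩`: `acc + a · b`
(sign-free accumulation `iaddFn`, exact canonical product `zmulF`). [cite: KnuthTAOCP2, §4.3.1] -/
def dotStep : List Bool → List Bool := iaddFn ∘ fanoutFn (sndPow 3) (zmulF ∘ fanoutFn (nthF 2) (nthF 3))

/-- Value of the accumulation step. [folklore] -/
theorem ival_dotStep (x p a b acc : List Bool) :
    ival (dotStep (boolPair x (boolPair p (boolPair a (boolPair b acc))))) = ival acc + ival a * ival b := by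
  simp [dotStep]

/-- `dotStep ∈ FP`. [folklore] -/
theorem dotStep_mem_FP : dotStep ∈ FP :=
  comp_mem_FP iaddFn_mem_FP (fanoutFn_mem_FP (sndPow_mem_FP 3) (comp_mem_FP zmulF_mem_FP (fanoutFn_mem_FP (nthF_mem_FP 2) (nthF_mem_FP 3))))

/-- Growth of the accumulation step: `≤ |acc| + 2(|a| + |b|) + 7`. [folklore] -/
theorem length_dotStep_le (x p a b acc : List Bool) :
    (dotStep (boolPair x (boolPair p (boolPair a (boolPair b acc))))).length ≤ acc.length + 2 * (a.length + b.length) + (7 : Polynomial ℕ).eval x.length := by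
  have h1 := length_iaddFn_boolPair_le acc (zmulF (boolPair a b))
  have h2 := length_zmulF_le a b
  have h3 := zlen_le_length a
  have h4 := zlen_le_length b
  simp only [dotStep, Function.comp_apply, fanoutFn_apply, sndPow_succ_boolPair, sndPow_zero, sndF_boolPair,
    nthF_succ_boolPair, nthF_zero_boolPair, eval_ofNat]
  omega

/-- **The dot product** on `⟨x, ⟨bin m, ⟨r₁, r₂⟩⟩⟩`: the canonical code of `∑ₜ vₜ wₜ`. [cite: KnuthTAOCP2, §4.3.1] -/
def dotF : List Bool → List Bool :=
  zcanonF ∘ zipFoldLF dotStep ∘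
    fanoutFn fstF (fanoutFn (nthF 1) (fanoutFn (fun _ => []) (fanoutFn (nthF 2) (fanoutFn (sndPow 2) (fun _ => dpEnc 0)))))

/-- `dotF ∈ FP`. [folklore] -/
theorem dotF_mem_FP : dotF ∈ FP :=
  comp_mem_FP zcanonF_mem_FP (comp_mem_FP (zipFoldLF_mem_FP dotStep_mem_FP (P := 7) length_dotStep_le)
    (fanoutFn_mem_FP fstF_mem_FP (fanoutFn_mem_FP (nthF_mem_FP 1) (fanoutFn_mem_FP (const_mem_FP _)
      (fanoutFn_mem_FP (nthF_mem_FP 2) (fanoutFn_mem_FP (sndPow_mem_FP 2) (const_mem_FP _)))))))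

/-- The value of the folded accumulation. [folklore] -/
theorem ival_zipFoldValue_dotStep (x p : List Bool) : ∀ (A B : List (List Bool)) (init : List Bool),
    ival (zipFoldValue dotStep x p A B init) = ival init + ((A.zip B).map fun ab => ival ab.1 * ival ab.2).sum
  | [], B, init => by simp [zipFoldValue]
  | a :: A, [], init => by simp [zipFoldValue]
  | a :: A, b :: B, init => by
    have := ival_zipFoldValue_dotStep x p A B (dotStep (boolPair x (boolPair p (boolPair a (boolPair b init)))))
    simp only [zipFoldValue, List.zip_cons_cons, List.foldl_cons, List.map_cons, List.sum_cons] at this ⊢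
    rw [this, ival_dotStep]; ring

/-- Zipping two `ofFn` lists. [folklore] -/
theorem zip_ofFn {α β : Type*} {m : ℕ} (f : Fin m → α) (g : Fin m → β) :
    (List.ofFn f).zip (List.ofFn g) = List.ofFn fun t => (f t, g t) := by
  apply List.ext_getElem (by simp)
  intro i h₁ h₂
  simp

/-- **Semantics of `dotF`** (`m ≤ |x|`). [folklore] -/
theorem dotF_apply (x : List Bool) {m : ℕ} (hm : m ≤ x.length) (v w : Fin m → ℤ) :
    dotF (boolPair x (boolPair (encodeNat m) (boolPair (rowCode v) (rowCode w)))) = dpEnc (∑ t, v t * w t) := by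
  simp only [dotF, Function.comp_apply, fanoutFn_apply, fstF_boolPair, nthF_succ_boolPair, nthF_zero_boolPair,
    sndPow_succ_boolPair, sndPow_zero, sndF_boolPair, rowCode, zlist_eq]
  rw [zipFoldLF_apply _ _ _ hm, zcanonF_eq, ival_zipFoldValue_dotStep, List.take_of_length_le (by simp),
    List.take_of_length_le (by simp), ival_dpEnc, zero_add, List.map_ofFn, List.map_ofFn, zip_ofFn, List.map_ofFn,
    List.sum_ofFn]
  simp

/-- Length of `dotF`: relative to its operands. [folklore] -/
theorem length_dotF_le (z : List Bool) :
    (dotF z).length ≤ 2 * ((nthF 2 z).length + (sndPow 2 z).length + 2 + (fstF z).length * 7) + 2 := by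
  rw [dotF, Function.comp_apply, Function.comp_apply, zcanonF_eq]
  set w := fanoutFn fstF (fanoutFn (nthF 1) (fanoutFn (fun _ => []) (fanoutFn (nthF 2) (fanoutFn (sndPow 2) (fun _ => dpEnc 0))))) z
  have h := length_zipFoldLF_le (f := dotStep) (P := 7) length_dotStep_le w
  have e3 : nthF 3 w = nthF 2 z := by simp [w]
  have e4 : nthF 4 w = sndPow 2 z := by simp [w]
  have e5 : sndPow 4 w = dpEnc 0 := by simp [w]
  have e0 : fstF w = fstF z := by simp [w]
  rw [e3, e4, e5, e0, dpEnc_zero, length_boolPair] at h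
  simp only [List.length_nil, eval_ofNat] at h
  have h2 := length_dpEnc_le_two_mul (ival (zipFoldLF dotStep w))
  have h3 := length_encodeNat_natAbs_ival_le (zipFoldLF dotStep w)
  have h4 := zlen_le_length (zipFoldLF dotStep w)
  omega

/-! ### The saturated Gram matrix -/

/-- The item function of a Gram row on `⟨x, ⟨⟨nn, rᵢ⟩, rⱼ⟩⟩`: `zcapF ⟨x, dot(rᵢ, rⱼ)⟩`. [folklore] -/
def gramItem : List Bool → List Bool :=
  zcapF ∘ fanoutFn (nthF 0) (dotF ∘ fanoutFn (nthF 0) (fanoutFn (fstF ∘ nthF 1) (fanoutFn (sndF ∘ nthF 1) (sndPow 1))))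

/-- `gramItem ∈ FP`. [folklore] -/
theorem gramItem_mem_FP : gramItem ∈ FP :=
  comp_mem_FP zcapF_mem_FP (fanoutFn_mem_FP (nthF_mem_FP 0) (comp_mem_FP dotF_mem_FP (fanoutFn_mem_FP (nthF_mem_FP 0)
    (fanoutFn_mem_FP (comp_mem_FP fstF_mem_FP (nthF_mem_FP 1)) (fanoutFn_mem_FP (comp_mem_FP sndF_mem_FP (nthF_mem_FP 1)) (sndPow_mem_FP 1))))))

/-- `gramItem` saturates: `|gramItem ⟨x, ⟨p, a⟩⟩| ≤ 2|x| + 2`. [folklore] -/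
theorem length_gramItem_le (x p a : List Bool) :
    (gramItem (boolPair x (boolPair p a))).length ≤ 0 * a.length + (2 * X + 2 : Polynomial ℕ).eval x.length := by
  have := length_zcapF_le (boolPair x (dotF (boolPair x (boolPair (fstF p) (boolPair (sndF p) a)))))
  simp only [gramItem, Function.comp_apply, fanoutFn_apply, nthF_zero_boolPair, nthF_succ_boolPair, sndPow_succ_boolPair,
    sndPow_zero, sndF_boolPair, fstF_boolPair, eval_add, eval_mul, eval_ofNat, eval_X, zero_mul, zero_add] at this ⊢
  exact this

/-- Semantics of `gramItem`. [folklore] -/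
theorem gramItem_apply (x : List Bool) {m : ℕ} (hm : m ≤ x.length) (v w : Fin m → ℤ) :
    gramItem (boolPair x (boolPair (boolPair (encodeNat m) (rowCode v)) (rowCode w))) =
      dpEnc (capZ x.length (∑ t, v t * w t)) := by
  simp only [gramItem, Function.comp_apply, fanoutFn_apply, nthF_zero_boolPair, nthF_succ_boolPair, sndPow_succ_boolPair,
    sndPow_zero, sndF_boolPair, fstF_boolPair]
  rw [dotF_apply x hm, zcapF_dpEnc, capZ]

/-- **A row of the saturated Gram matrix** on `⟨x, ⟨nn, ⟨rᵢ, M⟩⟩⟩`: the map of `gramItem` over the rows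
of `M` with parameter `⟨nn, rᵢ⟩`. [cite: Cohen1993, Algorithm 2.6.7 (input)] -/
def gramRowF : List Bool → List Bool :=
  mapLF gramItem ∘ fanoutFn (nthF 0) (fanoutFn (nthF 1) (fanoutFn (fanoutFn (nthF 1) (nthF 2)) (sndPow 2)))

/-- `gramRowF ∈ FP`. [folklore] -/
theorem gramRowF_mem_FP : gramRowF ∈ FP :=
  comp_mem_FP (mapLF_mem_FP gramItem_mem_FP (w := 0) (by norm_num) length_gramItem_le)
    (fanoutFn_mem_FP (nthF_mem_FP 0) (fanoutFn_mem_FP (nthF_mem_FP 1) (fanoutFn_mem_FP (fanoutFn_mem_FP (nthF_mem_FP 1) (nthF_mem_FP 2)) (sndPow_mem_FP 2))))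

/-- **Semantics of `gramRowF`**: row `i` of the saturated Gram matrix. [folklore] -/
theorem gramRowF_apply (x : List Bool) {n : ℕ} (hn : n ≤ x.length) (b : Fin n → (Fin n → ℤ)) (v : Fin n → ℤ) :
    gramRowF (boolPair x (boolPair (encodeNat n) (boolPair (rowCode v) (matCode b)))) =
      zlist (List.ofFn fun j : Fin n => capZ x.length (∑ t, v t * b j t)) := by
  simp only [gramRowF, Function.comp_apply, fanoutFn_apply, nthF_zero_boolPair, nthF_succ_boolPair, sndPow_succ_boolPair,
    sndPow_zero, sndF_boolPair, matCode]
  rw [mapLF_apply _ _ _ hn, List.take_of_length_le (by simp), List.map_ofFn, zlist_eq, List.map_ofFn]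
  refine congrArg encList (congrArg List.ofFn (funext fun j => ?_))
  simp only [Function.comp_apply]
  exact gramItem_apply x hn v (b j)

/-- Length of `gramRowF`: absolute, `≤ |x| (4|x| + 8)`. [folklore] -/
theorem length_gramRowF_le (z : List Bool) : (gramRowF z).length ≤ (fstF z).length * (4 * (fstF z).length + 8) := by
  rw [gramRowF, Function.comp_apply]
  set w := fanoutFn (nthF 0) (fanoutFn (nthF 1) (fanoutFn (fanoutFn (nthF 1) (nthF 2)) (sndPow 2))) z
  have h := length_mapLF_le (f := gramItem) 0 (P := 2 * X + 2) length_gramItem_le w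
  have e0 : fstF w = fstF z := by simp [w]
  rw [e0] at h
  simp only [zero_mul, zero_add, eval_add, eval_mul, eval_ofNat, eval_X] at h
  nlinarith

/-- The item function of the whole Gram table on `⟨x, ⟨⟨nn, M⟩, rᵢ⟩⟩`: the Gram row of `rᵢ`. [folklore] -/
def gramRowItem : List Bool → List Bool :=
  gramRowF ∘ fanoutFn (nthF 0) (fanoutFn (fstF ∘ nthF 1) (fanoutFn (sndPow 1) (sndF ∘ nthF 1)))

/-- `gramRowItem ∈ FP`. [folklore] -/
theorem gramRowItem_mem_FP : gramRowItem ∈ FP :=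
  comp_mem_FP gramRowF_mem_FP (fanoutFn_mem_FP (nthF_mem_FP 0) (fanoutFn_mem_FP (comp_mem_FP fstF_mem_FP (nthF_mem_FP 1))
    (fanoutFn_mem_FP (sndPow_mem_FP 1) (comp_mem_FP sndF_mem_FP (nthF_mem_FP 1)))))

/-- `gramRowItem` has absolutely bounded output: `≤ |x|(4|x| + 8)`. [folklore] -/
theorem length_gramRowItem_le (x p a : List Bool) :
    (gramRowItem (boolPair x (boolPair p a))).length ≤ 0 * a.length + (X * (4 * X + 8) : Polynomial ℕ).eval x.length := by
  have := length_gramRowF_le (boolPair x (boolPair (fstF p) (boolPair a (sndF p))))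
  simp only [gramRowItem, Function.comp_apply, fanoutFn_apply, nthF_zero_boolPair, nthF_succ_boolPair, sndPow_succ_boolPair,
    sndPow_zero, sndF_boolPair, fstF_boolPair, eval_add, eval_mul, eval_ofNat, eval_X, zero_mul, zero_add] at this ⊢
  exact this

/-- **The saturated Gram table** on `⟨x, ⟨nn, M⟩⟩`: Cohen's table at level `0`,
`u₀(i,j) = capZ W ⟪bᵢ, bⱼ⟫`. [cite: Cohen1993, Algorithm 2.6.7 (input)] -/
def gramF : List Bool → List Bool :=
  mapLF gramRowItem ∘ fanoutFn (nthF 0) (fanoutFn (nthF 1) (fanoutFn (fanoutFn (nthF 1) (sndPow 1)) (sndPow 1)))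

/-- `gramF ∈ FP`. [folklore] -/
theorem gramF_mem_FP : gramF ∈ FP :=
  comp_mem_FP (mapLF_mem_FP gramRowItem_mem_FP (w := 0) (by norm_num) length_gramRowItem_le)
    (fanoutFn_mem_FP (nthF_mem_FP 0) (fanoutFn_mem_FP (nthF_mem_FP 1) (fanoutFn_mem_FP (fanoutFn_mem_FP (nthF_mem_FP 1) (sndPow_mem_FP 1)) (sndPow_mem_FP 1))))

/-- The integer Gram entry as a `Fin`-sum. [folklore] -/
theorem intGram_eq_sum {n m : ℕ} (b : Fin n → (Fin m → ℤ)) (i j : Fin n) : intGram b i j = ∑ t, b i t * b j t := rfl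

/-- **Semantics of `gramF`**: `gramF ⟨x, ⟨bin n, matCode b⟩⟩ = tableCode |x| b 0`. [cite: Cohen1993, Algorithm 2.6.7] -/
theorem gramF_apply (x : List Bool) {n : ℕ} (hn : n ≤ x.length) (b : Fin n → (Fin n → ℤ)) :
    gramF (boolPair x (boolPair (encodeNat n) (matCode b))) = tableCode x.length b 0 := by
  simp only [gramF, Function.comp_apply, fanoutFn_apply, nthF_zero_boolPair, nthF_succ_boolPair, sndPow_succ_boolPair,
    sndPow_zero, sndF_boolPair]
  rw [matCode, mapLF_apply _ _ _ hn, List.take_of_length_le (by simp), List.map_ofFn, tableCode]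
  refine congrArg encList (congrArg List.ofFn (funext fun i => ?_))
  have := gramRowF_apply x hn b (b i)
  rw [matCode] at this
  simp only [gramRowItem, Function.comp_apply, fanoutFn_apply, nthF_zero_boolPair, nthF_succ_boolPair, sndPow_succ_boolPair,
    sndPow_zero, sndF_boolPair, fstF_boolPair]
  rw [this]
  refine congrArg zlist (congrArg List.ofFn (funext fun j => ?_))
  rw [uRecCap_zero, intGram_eq_sum]

/-- Length of `gramF`: absolute, `≤ |x| (2|x|(4|x|+8) + 4)`. [folklore] -/
theorem length_gramF_le (z : List Bool) :
    (gramF z).length ≤ (fstF z).length * (2 * ((fstF z).length * (4 * (fstF z).length + 8)) + 4) := by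
  rw [gramF, Function.comp_apply]
  set w := fanoutFn (nthF 0) (fanoutFn (nthF 1) (fanoutFn (fanoutFn (nthF 1) (sndPow 1)) (sndPow 1))) z
  have h := length_mapLF_le (f := gramRowItem) 0 (P := X * (4 * X + 8)) length_gramRowItem_le w
  have e0 : fstF w = fstF z := by simp [w]
  rw [e0] at h
  simp only [zero_mul, zero_add, eval_add, eval_mul, eval_ofNat, eval_X] at h
  exact h

/-! ### A column of a table, and one level of Cohen's recursion -/

/-- **A column of a table**: `colF ⟨x, ⟨nn, ⟨ll, U⟩⟩⟩` is the list of the `l`-th items of the rows of `U`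
(the map of `nthLF` with parameter `ll`). [folklore] -/
def colF : List Bool → List Bool := mapLF nthLF

/-- `colF ∈ FP`. [folklore] -/
theorem colF_mem_FP : colF ∈ FP :=
  mapLF_mem_FP nthLF_mem_FP (w := 1) (by norm_num) (P := 0) (fun x p a => by simpa using length_nthLF_le (boolPair x (boolPair p a)))

/-- Semantics of `colF` on a table of integer lists. [folklore] -/
theorem colF_apply (x : List Bool) {n : ℕ} (hn : n ≤ x.length) {l : ℕ} (hl : l < n) (R : Fin n → (Fin n → ℤ)) :
    colF (boolPair x (boolPair (encodeNat n) (boolPair (encodeNat l) (encList (List.ofFn fun i => zlist (List.ofFn (R i))))))) =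
      zlist (List.ofFn fun i => R i ⟨l, hl⟩) := by
  rw [colF, mapLF_apply _ _ _ hn, List.take_of_length_le (by simp), List.map_ofFn, zlist_eq, List.map_ofFn]
  refine congrArg encList (congrArg List.ofFn (funext fun i => ?_))
  simp only [Function.comp_apply]
  rw [zlist_eq, nthLF_apply x (by omega), getD_map_dpEnc _ _ (by simp [hl])]
  simp

/-- Length of `colF`: `≤ |U| + 4|x|`. [folklore] -/
theorem length_colF_le (z : List Bool) : (colF z).length ≤ (sndPow 2 z).length + 4 * (fstF z).length := by
  have h := length_mapLF_le (f := nthLF) 1 (P := 0) (fun x p a => by simpa using length_nthLF_le (boolPair x (boolPair p a))) z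
  simp only [one_mul, eval_zero, mul_zero, zero_add] at h
  rw [colF]; omega

/-- The entry function of a level step on `⟨x, ⟨⟨ull, ⟨uil, dl⟩⟩, ⟨uij, ujl⟩⟩⟩`:
`zcapF ⟨x, (ull · uij - ujl · uil) / dl⟩`. [cite: Cohen1993, Cor. 2.6.6 and Algorithm 2.6.7 Step 2] -/
def levelEntry : List Bool → List Bool :=
  zcapF ∘ fanoutFn (nthF 0)
    (zedivF ∘ fanoutFn
      (zsubF ∘ fanoutFn (zmulF ∘ fanoutFn (fstF ∘ nthF 1) (nthF 2)) (zmulF ∘ fanoutFn (sndPow 2) (fstF ∘ sndF ∘ nthF 1)))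
      (sndF ∘ sndF ∘ nthF 1))

/-- `levelEntry ∈ FP`. [folklore] -/
theorem levelEntry_mem_FP : levelEntry ∈ FP :=
  comp_mem_FP zcapF_mem_FP (fanoutFn_mem_FP (nthF_mem_FP 0) (comp_mem_FP zedivF_mem_FP (fanoutFn_mem_FP
    (comp_mem_FP zsubF_mem_FP (fanoutFn_mem_FP (comp_mem_FP zmulF_mem_FP (fanoutFn_mem_FP (comp_mem_FP fstF_mem_FP (nthF_mem_FP 1)) (nthF_mem_FP 2)))
      (comp_mem_FP zmulF_mem_FP (fanoutFn_mem_FP (sndPow_mem_FP 2) (comp_mem_FP fstF_mem_FP (comp_mem_FP sndF_mem_FP (nthF_mem_FP 1)))))))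
    (comp_mem_FP sndF_mem_FP (comp_mem_FP sndF_mem_FP (nthF_mem_FP 1))))))

/-- `levelEntry` saturates: `≤ 2|x| + 2`. [folklore] -/
theorem length_levelEntry_le (x p a c : List Bool) :
    (levelEntry (boolPair x (boolPair p (boolPair a c)))).length ≤ 0 * (a.length + c.length) + (2 * X + 2 : Polynomial ℕ).eval x.length := by
  rw [levelEntry, Function.comp_apply, fanoutFn_apply]
  have := length_zcapF_le (boolPair (nthF 0 (boolPair x (boolPair p (boolPair a c))))
    ((zedivF ∘ fanoutFn (zsubF ∘ fanoutFn (zmulF ∘ fanoutFn (fstF ∘ nthF 1) (nthF 2)) (zmulF ∘ fanoutFn (sndPow 2) (fstF ∘ sndF ∘ nthF 1)))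
      (sndF ∘ sndF ∘ nthF 1)) (boolPair x (boolPair p (boolPair a c)))))
  simp only [fstF_boolPair, nthF_zero_boolPair, eval_add, eval_mul, eval_ofNat, eval_X, zero_mul, zero_add] at this ⊢
  exact this

/-- Semantics of `levelEntry` on canonical codes. [folklore] -/
theorem levelEntry_apply (x : List Bool) (ull uil dl uij ujl : ℤ) :
    levelEntry (boolPair x (boolPair (boolPair (dpEnc ull) (boolPair (dpEnc uil) (dpEnc dl))) (boolPair (dpEnc uij) (dpEnc ujl)))) =
      dpEnc (capZ x.length ((ull * uij - ujl * uil) / dl)) := by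
  simp only [levelEntry, Function.comp_apply, fanoutFn_apply, nthF_zero_boolPair, nthF_succ_boolPair, sndPow_succ_boolPair,
    sndPow_zero, sndF_boolPair, fstF_boolPair, zmulF_boolPair, ival_dpEnc, zsubF_boolPair]
  rw [zedivF_dpEnc, zcapF_dpEnc, capZ]

/-- The row function of a level step on `⟨x, ⟨⟨nn, ⟨ll, ⟨ull, ⟨dl, col⟩⟩⟩⟩, rowᵢ⟩⟩`: with
`uil = rowᵢ[l]`, the zip of `levelEntry` over `(rowᵢ, col)` with parameter `⟨ull, ⟨uil, dl⟩⟩`. [folklore] -/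
def levelRow : List Bool → List Bool :=
  zipLF levelEntry ∘ fanoutFn (nthF 0) (fanoutFn (fstF ∘ nthF 1)
    (fanoutFn
      (fanoutFn (fstF ∘ sndF ∘ sndF ∘ nthF 1)                                  -- ull
        (fanoutFn (nthLF ∘ fanoutFn (nthF 0) (fanoutFn (fstF ∘ sndF ∘ nthF 1) (sndPow 1)))   -- uil = rowᵢ[l]
          (fstF ∘ sndF ∘ sndF ∘ sndF ∘ nthF 1)))                               -- dl
      (fanoutFn (sndPow 1) (sndF ∘ sndF ∘ sndF ∘ sndF ∘ nthF 1))))               -- (rowᵢ, col)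

/-- `levelRow ∈ FP`. [folklore] -/
theorem levelRow_mem_FP : levelRow ∈ FP :=
  comp_mem_FP (zipLF_mem_FP levelEntry_mem_FP (w := 0) (by norm_num) length_levelEntry_le)
    (fanoutFn_mem_FP (nthF_mem_FP 0) (fanoutFn_mem_FP (comp_mem_FP fstF_mem_FP (nthF_mem_FP 1))
      (fanoutFn_mem_FP
        (fanoutFn_mem_FP (comp_mem_FP fstF_mem_FP (comp_mem_FP sndF_mem_FP (comp_mem_FP sndF_mem_FP (nthF_mem_FP 1))))
          (fanoutFn_mem_FP (comp_mem_FP nthLF_mem_FP (fanoutFn_mem_FP (nthF_mem_FP 0) (fanoutFn_mem_FP (comp_mem_FP fstF_mem_FP (comp_mem_FP sndF_mem_FP (nthF_mem_FP 1))) (sndPow_mem_FP 1))))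
            (comp_mem_FP fstF_mem_FP (comp_mem_FP sndF_mem_FP (comp_mem_FP sndF_mem_FP (comp_mem_FP sndF_mem_FP (nthF_mem_FP 1)))))))
        (fanoutFn_mem_FP (sndPow_mem_FP 1) (comp_mem_FP sndF_mem_FP (comp_mem_FP sndF_mem_FP (comp_mem_FP sndF_mem_FP (comp_mem_FP sndF_mem_FP (nthF_mem_FP 1)))))))))

/-- `levelRow` has absolutely bounded output: `≤ |x| (4|x| + 8)`. [folklore] -/
theorem length_levelRow_le (x p a : List Bool) :
    (levelRow (boolPair x (boolPair p a))).length ≤ 0 * a.length + (X * (4 * X + 8) : Polynomial ℕ).eval x.length := by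
  rw [levelRow, Function.comp_apply]
  set w := (fanoutFn (nthF 0) (fanoutFn (fstF ∘ nthF 1) (fanoutFn (fanoutFn (fstF ∘ sndF ∘ sndF ∘ nthF 1)
    (fanoutFn (nthLF ∘ fanoutFn (nthF 0) (fanoutFn (fstF ∘ sndF ∘ nthF 1) (sndPow 1))) (fstF ∘ sndF ∘ sndF ∘ sndF ∘ nthF 1)))
    (fanoutFn (sndPow 1) (sndF ∘ sndF ∘ sndF ∘ sndF ∘ nthF 1))))) (boolPair x (boolPair p a))
  have h := length_zipLF_le (f := levelEntry) 0 (P := 2 * X + 2) length_levelEntry_le w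
  have e0 : fstF w = x := by simp [w]
  rw [e0] at h
  simp only [zero_mul, zero_add, eval_add, eval_mul, eval_ofNat, eval_X] at h ⊢
  nlinarith

/-- `zipImages` of a constant-parameter entry function over two `ofFn` lists. [folklore] -/
theorem zipImages_ofFn (f : List Bool → List Bool) (x prm : List Bool) {n : ℕ} (g h : Fin n → List Bool) :
    zipImages f x prm (List.ofFn g) (List.ofFn h) = List.ofFn fun i => f (boolPair x (boolPair prm (boolPair (g i) (h i)))) := by
  unfold zipImages
  apply List.ext_getElem (by simp)
  intro i h₁ h₂; simp

/-- **Semantics of `levelRow`** (`l < n ≤ |x|`): row `i` of the next level. [cite: Cohen1993, Algorithm 2.6.7 Step 2] -/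
theorem levelRow_apply (x : List Bool) {n : ℕ} (hn : n ≤ x.length) {l : ℕ} (hl : l < n) (ull dl : ℤ)
    (R : Fin n → (Fin n → ℤ)) (i : Fin n) :
    levelRow (boolPair x (boolPair
      (boolPair (encodeNat n) (boolPair (encodeNat l) (boolPair (dpEnc ull) (boolPair (dpEnc dl) (zlist (List.ofFn fun j => R j ⟨l, hl⟩))))))
      (zlist (List.ofFn (R i))))) =
      zlist (List.ofFn fun j : Fin n => capZ x.length ((ull * R i j - R j ⟨l, hl⟩ * R i ⟨l, hl⟩) / dl)) := by
  simp only [levelRow, Function.comp_apply, fanoutFn_apply, nthF_zero_boolPair, nthF_succ_boolPair, sndPow_succ_boolPair,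
    sndPow_zero, sndF_boolPair, fstF_boolPair]
  rw [zlist_eq, nthLF_apply x (by omega), getD_map_dpEnc _ _ (by simp [hl]), zlist_eq (List.ofFn fun j => R j ⟨l, hl⟩),
    zipLF_apply _ _ _ hn, List.take_of_length_le (by simp), List.take_of_length_le (by simp), List.map_ofFn, List.map_ofFn,
    zipImages_ofFn, zlist_eq, List.map_ofFn]
  refine congrArg encList (congrArg List.ofFn (funext fun j => ?_))
  simp only [Function.comp_apply, List.getElem_ofFn]
  exact levelEntry_apply x ull (R i ⟨l, hl⟩) dl (R i j) (R j ⟨l, hl⟩)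

/-- **One level of Cohen's recursion** on `⟨x, ⟨nn, ⟨ll, ⟨dl, U⟩⟩⟩⟩`: with `col` the `l`-th column of `U`
and `ull = col[l]`, the map of `levelRow` over the rows of `U`. [cite: Cohen1993, Algorithm 2.6.7 Step 2] -/
def levelF : List Bool → List Bool :=
  mapLF levelRow ∘ fanoutFn (nthF 0) (fanoutFn (nthF 1)
    (fanoutFn
      (fanoutFn (nthF 1) (fanoutFn (nthF 2)
        (fanoutFn (nthLF ∘ fanoutFn (nthF 0) (fanoutFn (nthF 2) (colF ∘ fanoutFn (nthF 0) (fanoutFn (nthF 1) (fanoutFn (nthF 2) (sndPow 3))))))  -- ull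
          (fanoutFn (nthF 3) (colF ∘ fanoutFn (nthF 0) (fanoutFn (nthF 1) (fanoutFn (nthF 2) (sndPow 3))))))))                                      -- dl, col
      (sndPow 3)))

/-- The parameter record of `levelF` is short: `≤` the pieces. (Helper for the length bound.) [folklore] -/
theorem levelF_eq (z : List Bool) :
    levelF z = mapLF levelRow (boolPair (nthF 0 z) (boolPair (nthF 1 z) (boolPair
      (boolPair (nthF 1 z) (boolPair (nthF 2 z) (boolPair
        (nthLF (boolPair (nthF 0 z) (boolPair (nthF 2 z) (colF (boolPair (nthF 0 z) (boolPair (nthF 1 z) (boolPair (nthF 2 z) (sndPow 3 z))))))))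
        (boolPair (nthF 3 z) (colF (boolPair (nthF 0 z) (boolPair (nthF 1 z) (boolPair (nthF 2 z) (sndPow 3 z)))))))))
      (sndPow 3 z)))) := by
  simp [levelF]

/-- `levelF ∈ FP`. [folklore] -/
theorem levelF_mem_FP : levelF ∈ FP :=
  comp_mem_FP (mapLF_mem_FP levelRow_mem_FP (w := 0) (by norm_num) length_levelRow_le)
    (fanoutFn_mem_FP (nthF_mem_FP 0) (fanoutFn_mem_FP (nthF_mem_FP 1)
      (fanoutFn_mem_FP
        (fanoutFn_mem_FP (nthF_mem_FP 1) (fanoutFn_mem_FP (nthF_mem_FP 2)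
          (fanoutFn_mem_FP (comp_mem_FP nthLF_mem_FP (fanoutFn_mem_FP (nthF_mem_FP 0) (fanoutFn_mem_FP (nthF_mem_FP 2)
              (comp_mem_FP colF_mem_FP (fanoutFn_mem_FP (nthF_mem_FP 0) (fanoutFn_mem_FP (nthF_mem_FP 1) (fanoutFn_mem_FP (nthF_mem_FP 2) (sndPow_mem_FP 3))))))))
            (fanoutFn_mem_FP (nthF_mem_FP 3) (comp_mem_FP colF_mem_FP (fanoutFn_mem_FP (nthF_mem_FP 0) (fanoutFn_mem_FP (nthF_mem_FP 1) (fanoutFn_mem_FP (nthF_mem_FP 2) (sndPow_mem_FP 3)))))))))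
        (sndPow_mem_FP 3))))

/-- **Semantics of `levelF`** (`l < n ≤ |x|`): `levelF ⟨x, ⟨bin n, ⟨bin l, ⟨dpEnc dₗ, tableCode |x| b l⟩⟩⟩⟩` is
`tableCode |x| b (l+1)`, by Cohen's recursion `uRecCap_succ`. [cite: Cohen1993, Cor. 2.6.6 and Algorithm 2.6.7 Step 2] -/
theorem levelF_apply (x : List Bool) {n m : ℕ} (hn : n ≤ x.length) {l : ℕ} (hl : l < n) (b : Fin n → (Fin m → ℤ)) :
    levelF (boolPair x (boolPair (encodeNat n) (boolPair (encodeNat l) (boolPair (dpEnc (dRecCap x.length b l)) (tableCode x.length b l))))) =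
      tableCode x.length b (l + 1) := by
  set R : Fin n → (Fin n → ℤ) := fun i j => uRecCap x.length b l i j with hR
  have hU : tableCode x.length b l = encList (List.ofFn fun i => zlist (List.ofFn (R i))) := rfl
  rw [levelF_eq]
  simp only [nthF_zero_boolPair, nthF_succ_boolPair, sndPow_succ_boolPair, sndPow_zero, sndF_boolPair]
  rw [hU, colF_apply x hn hl R, zlist_eq (List.ofFn fun i => R i ⟨l, hl⟩), nthLF_apply x (by omega),
    getD_map_dpEnc _ _ (by simp [hl]), ← zlist_eq, mapLF_apply _ _ _ hn, List.take_of_length_le (by simp), List.map_ofFn,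
    tableCode]
  refine congrArg encList (congrArg List.ofFn (funext fun i => ?_))
  simp only [Function.comp_apply, List.getElem_ofFn]
  rw [levelRow_apply x hn hl _ _ R i]
  refine congrArg zlist (congrArg List.ofFn (funext fun j => ?_))
  have e := uRecCap_succ x.length b ⟨l, hl⟩ i j
  have ed : dRecCap x.length b l = dRecCap x.length b (((⟨l, hl⟩ : Fin n) : ℕ)) := rfl
  rw [ed, e]

/-- Length of `levelF`: absolute, `≤ |x| (2|x|(4|x|+8) + 4)`. [folklore] -/
theorem length_levelF_le (z : List Bool) :
    (levelF z).length ≤ (fstF z).length * (2 * ((fstF z).length * (4 * (fstF z).length + 8)) + 4) := by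
  rw [levelF, Function.comp_apply]
  set w := (fanoutFn (nthF 0) (fanoutFn (nthF 1) (fanoutFn (fanoutFn (nthF 1) (fanoutFn (nthF 2)
    (fanoutFn (nthLF ∘ fanoutFn (nthF 0) (fanoutFn (nthF 2) (colF ∘ fanoutFn (nthF 0) (fanoutFn (nthF 1) (fanoutFn (nthF 2) (sndPow 3))))))
      (fanoutFn (nthF 3) (colF ∘ fanoutFn (nthF 0) (fanoutFn (nthF 1) (fanoutFn (nthF 2) (sndPow 3)))))))) (sndPow 3)))) z
  have h := length_mapLF_le (f := levelRow) 0 (P := X * (4 * X + 8)) length_levelRow_le w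
  have e0 : fstF w = fstF z := by simp [w]
  rw [e0] at h
  simp only [zero_mul, zero_add, eval_add, eval_mul, eval_ofNat, eval_X] at h
  exact h

end LLLMachine

end Literature.Algebra.EuclideanLattices
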